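import Literature.NumberTheory.GaloisRepresentations.ContinuousCohomologyNineTerm
import Literature.NumberTheory.GaloisRepresentations.CorNaturality
import HarnessLib

/-!
# The degree-`3` connecting cocycle of a short exact sequence, and the index-`2` sequence
# `0 → T → M_G^S(T) → T → 0` (K4 `SignedControlAtTwo`, base case of Milne I Thm. 4.10 (c)₃)

Route `ThetaPartnerAtTwo` (TP2), crux K4 `SignedControlAtTwo` (stmt-BirchSwinnertonDyer-20309), line `eulerchar` v12,
stub `stub_poitouTateThreeRealRat`.  The lead's dévissage (`…ShaThreeAssembly.poitouTate_three_realPlaces_injective_of_devissage`)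
displays the CFT base case as its binder `hbase` (real-place injectivity of `H³(F, T)` for a TRIVIAL `Γ_F`-module `T` of
order `2`).  This file (width seat `bsd-wall-tp2-p3-w2`, gen 7) is the GROUP-COHOMOLOGICAL layer of the base case:
* §1 (any short exact sequence `0 → M₁ →ᶠ M₂ →ᵍ M₃ → 0` of discrete modules over a locally compact group): the
  **connecting `3`-cocycle** `z = f⁻¹(dỹ) ∈ Z³(M₁)` of a continuous `2`-cochain `ỹ` of `M₂` (phrased by `f ∘ z = dỹ`; the
  tree's long exact sequence `ContinuousCohomologyConnecting.lean` stops at `δ₁ : H¹ → H²`), and the exactness statements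
  around `H²(M₃) → H³(M₁) → H³(M₂)` in element form (`exists_conn_eq_of_map_three_eq_zero`,
  `threeCocycleClass_conn_eq_zero_of_exists`, `twoCocycleClass_comp_eq_zero_of_conn`).
* §2 (profinite `G`, OPEN subgroup `S` of index `2`, discrete `G`-module `T` with TRIVIAL action and `2T = 0`): the sequence
  `0 → T →unit→ M_G^S(T) →norm→ T → 0` (tree `unitCoind`/`normCoind`) is SHORT EXACT (`isSES_unitCoind_normCoind`), and via
  the tree's Shapiro machinery (`res = sh ∘ H(unit)`, `cor = H(norm) ∘ ext`, `ext ∘ sh = id`, Shapiro injectivity):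
  (α1) `exists_conn_eq_of_resH_three_eq_zero` — a class of `H³(G, T)` dying on `S` is a connecting class;
  (α2) `threeCocycleClass_conn_eq_zero_of_mem_range_cor` — the connecting class of `ỹ` vanishes when
  `[norm ∘ ỹ] ∈ cor(H²(S, T))`; (α3) `mem_range_cor_two_of_subsingleton_three` — if `H³(G, T) = 0` then `cor : H²(S) → H²(G)`
  is onto.  (The Gysin sequence `H²(S) →cor→ H²(G) →∪χ_S→ H³(G) →res→ H³(S)` of an index-`2` subgroup, element form.)

HONEST FRAMING: THEOREMS ONLY (no definition, no named fact, no `sorry`); closes no item by itself; BSD is not proved by any of this.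
References: [SerreGaloisCohomology1997] I §2.2–§2.5; [NeukirchSchmidtWingberg2008] I §3, I §6 (1.6.4); [MilneADT2006] I 4.10 (c).
-/

set_option autoImplicit false
-- the Theorems namespace of this sub repeats the summit name by design (D-0017 nested layout)
set_option linter.dupNamespace false

noncomputable section

open CategoryTheory Function
open _root_.TopRep _root_.ContRepresentation _root_.ContinuousCohomology
open Literature.NumberTheory.GaloisRepresentations

universe u

namespace Summit.BirchSwinnertonDyer.BirchSwinnertonDyer.Theorems.SignedEC.ShaThreeBase

/-! ## §1 The connecting `3`-cocycle `f⁻¹(dỹ)` and exactness around `H²(M₃) → H³(M₁) → H³(M₂)` -/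

section Connecting

variable {A : Type*} [CommRing A] [TopologicalSpace A]
variable {Γ : Type u} [Group Γ] [TopologicalSpace Γ] [IsTopologicalGroup Γ] [LocallyCompactSpace Γ]
variable {M₁ : Type u} [AddCommGroup M₁] [Module A M₁] [TopologicalSpace M₁] [DiscreteTopology M₁]
  [ContinuousSMul A M₁]
variable {M₂ : Type u} [AddCommGroup M₂] [Module A M₂] [TopologicalSpace M₂] [DiscreteTopology M₂]
  [ContinuousSMul A M₂]
variable {M₃ : Type u} [AddCommGroup M₃] [Module A M₃] [TopologicalSpace M₃] [DiscreteTopology M₃]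
  [ContinuousSMul A M₃]
variable {ρ₁ : ContinuousRep Γ A M₁} {ρ₂ : ContinuousRep Γ A M₂} {ρ₃ : ContinuousRep Γ A M₃}
variable {f : ρ₁.toTopRep ⟶ ρ₂.toTopRep} {g : ρ₂.toTopRep ⟶ ρ₃.toTopRep}

omit [IsTopologicalGroup Γ] [LocallyCompactSpace Γ] in
/-- A morphism of modules commutes with the coboundary of `2`-cochains: `g (dỹ) = d(g ∘ ỹ)`. [folklore] -/
theorem hom_dTwo (g : ρ₂.toTopRep ⟶ ρ₃.toTopRep) (b : C(Γ × Γ, M₂)) (σ τ υ : Γ) :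
    g.hom (dTwo ρ₂.toTopRep b σ τ υ) =
      dTwo ρ₃.toTopRep ((⟨g.hom, g.hom.continuous⟩ : C(M₂, M₃)).comp b) σ τ υ := by
  rw [dTwo_apply, dTwo_apply, map_sub, map_add, map_sub, TopRep.hom_comm_apply g σ]
  rfl

omit [IsTopologicalGroup Γ] [LocallyCompactSpace Γ] in
/-- If `f ∘ z = dỹ` pointwise (a **connecting `3`-cocycle** `z = f⁻¹(dỹ)` of `0 → M₁ →ᶠ M₂ →ᵍ M₃ → 0`, Serre I §2.2),
then `g(dỹ) = 0`, i.e. `g ∘ ỹ` is a continuous `2`-cocycle of `M₃`. [cite: SerreGaloisCohomology1997, I §2.2] -/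
theorem comp_mem_contTwoCocycles_of_conn (h : IsSES f g) (yt : C(Γ × Γ, M₂)) (z : contThreeCocycles ρ₁.toTopRep)
    (hz : ∀ σ τ υ : Γ, f.hom (z.1 (σ, τ, υ)) = dTwo ρ₂.toTopRep yt σ τ υ) :
    (⟨g.hom, g.hom.continuous⟩ : C(M₂, M₃)).comp yt ∈ contTwoCocycles ρ₃.toTopRep :=
  (mem_contTwoCocycles_iff_dTwo _ _).2 fun σ τ υ => by rw [← hom_dTwo, ← hz]; exact h.g_f_apply _

/-- **Exactness at `H³(M₁)`**: a class `x ∈ H³(Γ, M₁)` with `H³(f) x = 0` is the class of a connecting cocycle: `x = [z]`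
with `f ∘ z = dỹ` for a continuous `2`-cochain `ỹ` of `M₂`. [cite: SerreGaloisCohomology1997, I §2.2]
[cite: NeukirchSchmidtWingberg2008, I §3] -/
theorem exists_conn_eq_of_map_three_eq_zero (x : continuousCohomology 3 ρ₁.toTopRep)
    (hx : cohomologyMap f 3 x = 0) :
    ∃ (yt : C(Γ × Γ, M₂)) (z : contThreeCocycles ρ₁.toTopRep),
      (∀ σ τ υ : Γ, f.hom (z.1 (σ, τ, υ)) = dTwo ρ₂.toTopRep yt σ τ υ) ∧ threeCocycleClass ρ₁.toTopRep z = x := by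
  obtain ⟨z, rfl⟩ := threeCocycleClass_surjective _ x
  have hx' : threeCocycleClass ρ₂.toTopRep
      (contThreeCocycles.pullback (ContinuousMonoidHom.id Γ) (resIdHom f) z) = 0 := by
    rw [← hx]; exact (map_threeCocycleClass _ _ _ z).symm
  obtain ⟨b, hb⟩ := (threeCocycleClass_eq_zero_iff_dTwo _ _).1 hx'
  exact ⟨b, z, fun σ τ υ => hb σ τ υ, rfl⟩

/-- **Exactness at `H²(M₃)`/`H³(M₁)`**: if `f ∘ z = dỹ` and `[g ∘ ỹ] ∈ H²(Γ, M₃)` is the image of a class of `H²(Γ, M₂)`,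
the connecting class `[z]` vanishes (`ỹ = Y + d̃β + f ∘ a` with `Y` a cocycle; then `dỹ = f(da)`, `z = da`).
[cite: SerreGaloisCohomology1997, I §2.2] [cite: NeukirchSchmidtWingberg2008, I §3] -/
theorem threeCocycleClass_conn_eq_zero_of_exists (h : IsSES f g) (yt : C(Γ × Γ, M₂)) (z : contThreeCocycles ρ₁.toTopRep)
    (hz : ∀ σ τ υ : Γ, f.hom (z.1 (σ, τ, υ)) = dTwo ρ₂.toTopRep yt σ τ υ)
    (hex : ∃ Y : contTwoCocycles ρ₂.toTopRep, cohomologyMap g 2 (twoCocycleClass _ Y) =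
      twoCocycleClass ρ₃.toTopRep ⟨_, comp_mem_contTwoCocycles_of_conn h yt z hz⟩) :
    threeCocycleClass ρ₁.toTopRep z = 0 := by
  obtain ⟨Y, hY⟩ := hex
  rw [cohomologyMap_twoCocycleClass, ← sub_eq_zero, ← twoCocycleClass_sub, twoCocycleClass_eq_zero_iff] at hY
  obtain ⟨β, hβ⟩ := hY
  have hβ' : ∀ σ τ, g.hom (Y.1 (σ, τ)) - g.hom (yt (σ, τ)) = ρ₃ σ (β τ) - β (σ * τ) + β σ :=
    fun σ τ => hβ σ τ
  -- lift `β` and peel off the cocycle and the coboundary: the rest is `f ∘ a`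
  let βt : C(Γ, M₂) := ⟨h.lift ∘ β, (continuous_of_discreteTopology (f := h.lift)).comp β.continuous⟩
  have hβt : ∀ σ, g.hom (βt σ) = β σ := fun σ => h.g_lift _
  let e : C(Γ × Γ, M₂) := yt - Y.1 + (ρ₂.twoCoboundary βt).1
  have he : ∀ p, g.hom (e p) = 0 := fun ⟨σ, τ⟩ => by
    change g.hom (yt (σ, τ) - Y.1 (σ, τ) + (ρ₂ σ (βt τ) - βt (σ * τ) + βt σ)) = 0
    rw [map_add, map_sub, map_add, map_sub, ContinuousRep.hom_comm_apply g σ, hβt, hβt, hβt, ← hβ' σ τ]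
    abel
  let a : C(Γ × Γ, M₁) := ⟨h.inv ∘ e, (continuous_of_discreteTopology (f := h.inv)).comp e.continuous⟩
  have hfa : (⟨f.hom, f.hom.continuous⟩ : C(M₁, M₂)).comp a = e :=
    ContinuousMap.ext fun p => h.f_inv (he p)
  have hdyt : ∀ σ τ υ, dTwo ρ₂.toTopRep yt σ τ υ = f.hom (dTwo ρ₁.toTopRep a σ τ υ) := fun σ τ υ => by
    have h1 : dTwo ρ₂.toTopRep e σ τ υ =
        dTwo ρ₂.toTopRep yt σ τ υ - dTwo ρ₂.toTopRep Y.1 σ τ υ +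
          dTwo ρ₂.toTopRep (ρ₂.twoCoboundary βt).1 σ τ υ := by
      rw [← dTwo_sub, ← dTwo_add]
    rw [dTwo_coe_contTwoCocycles, dTwo_coe_contTwoCocycles, add_zero, sub_zero] at h1
    rw [← h1, hom_dTwo, hfa]
  refine (threeCocycleClass_eq_zero_iff_dTwo _ _).2 ⟨a, fun σ τ υ => h.injective ?_⟩
  rw [hz, hdyt]

/-- **Exactness at `H²(M₃)` read backwards**: if `f ∘ z = dỹ`, the connecting class `[z]` vanishes and `H²(Γ, M₂) = 0`,
then `[g ∘ ỹ] = 0` in `H²(Γ, M₃)` (`z = dγ` makes `ỹ - f ∘ γ` a cocycle of `M₂` lifting `g ∘ ỹ`).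
[cite: SerreGaloisCohomology1997, I §2.2] [cite: NeukirchSchmidtWingberg2008, I §3] -/
theorem twoCocycleClass_comp_eq_zero_of_conn (h : IsSES f g) (yt : C(Γ × Γ, M₂)) (z : contThreeCocycles ρ₁.toTopRep)
    (hz : ∀ σ τ υ : Γ, f.hom (z.1 (σ, τ, υ)) = dTwo ρ₂.toTopRep yt σ τ υ)
    (hconn : threeCocycleClass ρ₁.toTopRep z = 0) (h2 : Subsingleton (continuousCohomology 2 ρ₂.toTopRep)) :
    twoCocycleClass ρ₃.toTopRep ⟨_, comp_mem_contTwoCocycles_of_conn h yt z hz⟩ = 0 := by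
  obtain ⟨γ, hγ⟩ := (threeCocycleClass_eq_zero_iff_dTwo _ _).1 hconn
  have hγ' : ∀ σ τ υ, dTwo ρ₂.toTopRep yt σ τ υ =
      dTwo ρ₂.toTopRep ((⟨f.hom, f.hom.continuous⟩ : C(M₁, M₂)).comp γ) σ τ υ := fun σ τ υ => by
    rw [← hom_dTwo, ← hz]
    exact congrArg f.hom (hγ σ τ υ)
  let Y : contTwoCocycles ρ₂.toTopRep :=
    ⟨yt - (⟨f.hom, f.hom.continuous⟩ : C(M₁, M₂)).comp γ,
      (mem_contTwoCocycles_iff_dTwo _ _).2 fun σ τ υ => by rw [dTwo_sub, hγ', sub_self]⟩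
  have hY : cohomologyMap g 2 (twoCocycleClass _ Y) =
      twoCocycleClass ρ₃.toTopRep ⟨_, comp_mem_contTwoCocycles_of_conn h yt z hz⟩ := by
    rw [cohomologyMap_twoCocycleClass]
    refine congrArg _ (Subtype.ext (ContinuousMap.ext fun p => ?_))
    change g.hom (yt p - f.hom (γ p)) = g.hom (yt p)
    rw [map_sub, h.g_f_apply, sub_zero]
  rw [← hY, Subsingleton.elim (twoCocycleClass _ Y) 0, map_zero]

end Connecting

/-! ## §2 The index-`2` sequence `0 → T → M_G^S(T) → T → 0` for a trivial module of exponent `2` -/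

section IndexTwoGroup

variable {G : Type u} [Group G] {S : Subgroup G}

/-- In a subgroup of index `2`, the product of two non-members is a member. [folklore] -/
theorem mul_mem_of_not_mem_of_index_two (hidx : S.index = 2) {a b : G} (ha : a ∉ S) (hb : b ∉ S) :
    a * b ∈ S :=
  (Subgroup.mul_mem_iff_of_index_two hidx).2 (iff_of_false ha hb)

/-- `1̄ ≠ σ̄₀` in `G/S` for `σ₀ ∉ S`. [folklore] -/
theorem one_ne_coe_of_not_mem {σ₀ : G} (hσ₀ : σ₀ ∉ S) : ((1 : G) : G ⧸ S) ≠ (σ₀ : G ⧸ S) := fun h =>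
  hσ₀ (by simpa only [inv_one, one_mul] using QuotientGroup.eq.1 h)

/-- For `S` of index `2` and `σ₀ ∉ S`, the cosets are `S` and `σ₀ S`: `G/S = {1̄, σ̄₀}`. [folklore] -/
theorem univ_quotient_eq_pair_of_index_two [Fintype (G ⧸ S)] [DecidableEq (G ⧸ S)] (hidx : S.index = 2)
    {σ₀ : G} (hσ₀ : σ₀ ∉ S) :
    (Finset.univ : Finset (G ⧸ S)) = {((1 : G) : G ⧸ S), (σ₀ : G ⧸ S)} := by
  symm
  refine Finset.eq_of_subset_of_card_le (Finset.subset_univ _) ?_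
  rw [Finset.card_univ, ← Nat.card_eq_fintype_card, ← Subgroup.index_eq_card, hidx,
    Finset.card_pair (one_ne_coe_of_not_mem hσ₀)]

/-- A subgroup of index `2` is proper: some `σ₀ ∉ S`. [folklore] -/
theorem exists_not_mem_of_index_two (hidx : S.index = 2) : ∃ σ₀ : G, σ₀ ∉ S := by
  by_contra hall
  have htop : S = ⊤ := (Subgroup.eq_top_iff' S).2 fun x => not_not.1 (not_exists.1 hall x)
  rw [htop, Subgroup.index_top] at hidx
  exact absurd hidx (by norm_num)

end IndexTwoGroup

section IndexTwo

variable {G : Type u} [Group G] [TopologicalSpace G] [IsTopologicalGroup G] [CompactSpace G]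
  [T2Space G] [TotallyDisconnectedSpace G]
variable {S : Subgroup G} [Fintype (G ⧸ S)]
variable {T : Type u} [AddCommGroup T] [TopologicalSpace T] [DiscreteTopology T]
variable (ρ : ContinuousRep G ℤ T)

omit [T2Space G] [TotallyDisconnectedSpace G] in
/-- **The norm of the index-`2` induced module of a TRIVIAL module**: `norm(a*) = a*(1) + a*(σ₀⁻¹)` for any
`σ₀ ∉ S` (the two cosets `S`, `σ₀ S`). [cite: SerreGaloisCohomology1997, I §2.5] -/
theorem normCoind_hom_eq_of_index_two (htriv : ∀ (x : G) (t : T), ρ x t = t) (hidx : S.index = 2)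
    {σ₀ : G} (hσ₀ : σ₀ ∉ S) (F : coindModule (ρ.restrict (subgroupIncl S))) :
    (normCoind ρ).hom F = (F : C(G, T)) 1 + (F : C(G, T)) σ₀⁻¹ := by
  classical
  rw [normCoind_hom_apply]
  have hterm : ∀ c : G ⧸ S, ρ c.out ((F : C(G, T)) c.out⁻¹) = normTerm ρ F c.out := fun _ => rfl
  simp_rw [hterm]
  rw [univ_quotient_eq_pair_of_index_two hidx hσ₀, Finset.sum_pair]
  · rw [normTerm_eq_of_coe_eq ρ F (QuotientGroup.out_eq' ((1 : G) : G ⧸ S)),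
      normTerm_eq_of_coe_eq ρ F (QuotientGroup.out_eq' (σ₀ : G ⧸ S))]
    change ρ 1 ((F : C(G, T)) 1⁻¹) + ρ σ₀ ((F : C(G, T)) σ₀⁻¹) = _
    rw [htriv, htriv, inv_one]
  · exact one_ne_coe_of_not_mem hσ₀

omit [IsTopologicalGroup G] [CompactSpace G] [T2Space G] [TotallyDisconnectedSpace G] [Fintype (G ⧸ S)] in
/-- An element of the induced module `M_G^S(T)` of a trivial module is left `S`-invariant: `a*(s x) = a*(x)`.
[cite: SerreGaloisCohomology1997, I §2.5] -/
theorem coind_apply_mul_of_mem (htriv : ∀ (x : G) (t : T), ρ x t = t)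
    (F : coindModule (ρ.restrict (subgroupIncl S))) {s : G} (hs : s ∈ S) (x : G) :
    (F : C(G, T)) (s * x) = (F : C(G, T)) x := by
  have h := (mem_coind_iff (ρ.restrict (subgroupIncl S)) _).1 F.2 ⟨s, hs⟩ x
  rw [h]
  exact htriv s _

omit [IsTopologicalGroup G] [CompactSpace G] [T2Space G] [TotallyDisconnectedSpace G] [Fintype (G ⧸ S)] in
/-- On `S`, an element `a*` of `M_G^S(T)` (`T` trivial) is constant: `a*(x) = a*(1)`. [folklore] -/
theorem coind_apply_of_mem (htriv : ∀ (x : G) (t : T), ρ x t = t)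
    (F : coindModule (ρ.restrict (subgroupIncl S))) {x : G} (hx : x ∈ S) : (F : C(G, T)) x = (F : C(G, T)) 1 := by
  simpa only [mul_one] using coind_apply_mul_of_mem ρ htriv F hx 1

omit [IsTopologicalGroup G] [CompactSpace G] [T2Space G] [TotallyDisconnectedSpace G] [Fintype (G ⧸ S)] in
/-- Off `S` (of index `2`, `σ₀ ∉ S`), an element `a*` of `M_G^S(T)` (`T` trivial) is constant: `a*(x) = a*(σ₀⁻¹)`.
[folklore] -/
theorem coind_apply_of_not_mem (htriv : ∀ (x : G) (t : T), ρ x t = t) (hidx : S.index = 2)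
    {σ₀ : G} (hσ₀ : σ₀ ∉ S) (F : coindModule (ρ.restrict (subgroupIncl S))) {x : G} (hx : x ∉ S) :
    (F : C(G, T)) x = (F : C(G, T)) σ₀⁻¹ := by
  have hmem : x * σ₀ ∈ S := mul_mem_of_not_mem_of_index_two hidx hx hσ₀
  rw [← coind_apply_mul_of_mem ρ htriv F hmem σ₀⁻¹, mul_inv_cancel_right]

omit [T2Space G] [TotallyDisconnectedSpace G] in
/-- **The index-`2` sequence is short exact**: for a profinite (here: compact) group `G`, an open subgroup `S` of index
`2` and a discrete `G`-module `T` with TRIVIAL action and `2T = 0`, the sequence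
`0 → T →unit→ M_G^S(T) →norm→ T → 0` (`unit a = (x ↦ a)`, `norm a* = a*(1) + a*(σ₀⁻¹)`) is exact: the kernel of the
norm is the constants because `-t = t`, and the indicator of `S` maps to any prescribed `t`.
[cite: SerreGaloisCohomology1997, I §2.5] [cite: NeukirchSchmidtWingberg2008, I §6 Prop. (1.6.4)] -/
theorem isSES_unitCoind_normCoind (htriv : ∀ (x : G) (t : T), ρ x t = t) (h2 : ∀ t : T, 2 • t = 0)
    (hSo : IsOpen (S : Set G)) (hidx : S.index = 2) :
    IsSES (unitCoind (S := S) ρ) (normCoind ρ) := by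
  classical
  -- an element off `S`
  obtain ⟨σ₀, hσ₀⟩ := exists_not_mem_of_index_two hidx
  have hneg : ∀ t : T, -t = t := fun t => by
    rw [neg_eq_iff_add_eq_zero, ← two_nsmul]; exact h2 t
  refine ⟨?_, ?_, ?_, ?_⟩
  · -- `norm ∘ unit = 2 = 0`
    ext a
    change (normCoind ρ).hom ((unitCoind (S := S) ρ).hom a) = 0
    rw [normCoind_unitCoind, ← Nat.card_eq_fintype_card, ← Subgroup.index_eq_card, hidx, h2]
  · -- `unit` is injective (evaluate at `1`)
    intro a b hab
    have := congrArg (fun F : coindModule (ρ.restrict (subgroupIncl S)) => (F : C(G, T)) 1) hab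
    change ρ 1 a = ρ 1 b at this
    rwa [htriv, htriv] at this
  · -- exactness in the middle
    intro F hF
    rw [normCoind_hom_eq_of_index_two ρ htriv hidx hσ₀] at hF
    have h1 : (F : C(G, T)) σ₀⁻¹ = (F : C(G, T)) 1 := by
      rw [← hneg ((F : C(G, T)) 1)]
      exact (neg_eq_of_add_eq_zero_right hF).symm
    refine ⟨(F : C(G, T)) 1, Subtype.ext (ContinuousMap.ext fun x => ?_)⟩
    rw [unitCoind_hom_coe_apply, htriv]
    by_cases hx : x ∈ S
    · rw [coind_apply_of_mem ρ htriv F hx]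
    · rw [coind_apply_of_not_mem ρ htriv hidx hσ₀ F hx, h1]
  · -- the norm is onto: the indicator of `S` (continuous: `S` is clopen; left `S`-invariant) maps to `t`
    intro t
    have hcont : Continuous ((S : Set G).indicator (fun _ : G => t)) := by
      refine IsLocallyConstant.continuous ((IsLocallyConstant.iff_exists_open _).2 fun x => ?_)
      by_cases hx : x ∈ S
      · refine ⟨S, hSo, hx, fun y hy => ?_⟩
        rw [Set.indicator_of_mem (show y ∈ (S : Set G) from hy), Set.indicator_of_mem (show x ∈ (S : Set G) from hx)]
      · refine ⟨(S : Set G)ᶜ, (Subgroup.isClosed_of_isOpen S hSo).isOpen_compl, hx, fun y hy => ?_⟩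
        rw [Set.indicator_of_notMem (show y ∉ (S : Set G) from hy),
          Set.indicator_of_notMem (show x ∉ (S : Set G) from hx)]
    have hmem : (⟨_, hcont⟩ : C(G, T)) ∈ coindModule (ρ.restrict (subgroupIncl S)) := fun s x => by
      change (S : Set G).indicator (fun _ => t) ((s : G) * x) = ρ (subgroupIncl S s) ((S : Set G).indicator (fun _ => t) x)
      rw [subgroupIncl_apply, htriv]
      by_cases hx : x ∈ S
      · rw [Set.indicator_of_mem (show x ∈ (S : Set G) from hx),
          Set.indicator_of_mem (show (s : G) * x ∈ (S : Set G) from S.mul_mem s.2 hx)]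
      · rw [Set.indicator_of_notMem (show x ∉ (S : Set G) from hx),
          Set.indicator_of_notMem (show (s : G) * x ∉ (S : Set G) from
            fun h => hx ((Subgroup.mul_mem_cancel_left S s.2).1 h))]
    refine ⟨⟨_, hmem⟩, ?_⟩
    rw [normCoind_hom_eq_of_index_two ρ htriv hidx hσ₀]
    change (S : Set G).indicator (fun _ => t) 1 + (S : Set G).indicator (fun _ => t) σ₀⁻¹ = t
    rw [Set.indicator_of_mem (show (1 : G) ∈ (S : Set G) from S.one_mem),
      Set.indicator_of_notMem (show σ₀⁻¹ ∉ (S : Set G) from fun h => hσ₀ (by simpa using S.inv_mem h)), add_zero]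

omit [Fintype (G ⧸ S)] in
/-- (α1) **A class of `H³(G, T)` dying on the index-`2` subgroup `S` is a connecting class**: if `res_S c = 0` then
`c = [z]` with `unit ∘ z = dỹ` for a continuous `2`-cochain `ỹ : G × G → M_G^S(T)` (so `norm ∘ ỹ` is a `2`-cocycle of
`T`): `res = sh ∘ H³(unit)` and Shapiro injectivity give `H³(unit) c = 0`, then §1.
[cite: SerreGaloisCohomology1997, I §2.5 Prop. 10] [cite: NeukirchSchmidtWingberg2008, I §3] -/
theorem exists_conn_eq_of_resH_three_eq_zero (hSo : IsOpen (S : Set G)) (c : continuousCohomology 3 ρ.toTopRep)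
    (hc : resH S ρ 3 c = 0) :
    ∃ (yt : C(G × G, coindModule (ρ.restrict (subgroupIncl S)))) (z : contThreeCocycles ρ.toTopRep),
      (∀ σ τ υ : G, (unitCoind (S := S) ρ).hom (z.1 (σ, τ, υ)) =
        dTwo (coindRep (ρ.restrict (subgroupIncl S))).toTopRep yt σ τ υ) ∧ threeCocycleClass ρ.toTopRep z = c := by
  haveI : IsClosed (S : Set G) := Subgroup.isClosed_of_isOpen S hSo
  have h1 := resH_eq_shMap_unitCoind (S := S) ρ 3 c
  rw [hc] at h1
  have h0 : cohomologyMap (unitCoind (S := S) ρ) 3 c = 0 :=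
    map_shapiro_eq_zero_imp (ρ.restrict (subgroupIncl S)) 2 _ (by
      change shMap S ρ 3 (cohomologyMap (unitCoind (S := S) ρ) 3 c) = 0
      exact h1.symm)
  exact exists_conn_eq_of_map_three_eq_zero c h0

/-- (α2) **The connecting class of `ỹ` vanishes as soon as `[norm ∘ ỹ] ∈ cor(H²(S, T))`** (`cor = H²(norm) ∘ ext`, so
a corestriction is the image of a class of `H²(G, M_G^S(T))`; then §1).
[cite: SerreGaloisCohomology1997, I §2.5] [cite: NeukirchSchmidtWingberg2008, I §3] -/
theorem threeCocycleClass_conn_eq_zero_of_mem_range_cor [hS : IsClosed (S : Set G)]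
    (hSES : IsSES (unitCoind (S := S) ρ) (normCoind ρ))
    (yt : C(G × G, coindModule (ρ.restrict (subgroupIncl S)))) (z : contThreeCocycles ρ.toTopRep)
    (hz : ∀ σ τ υ : G, (unitCoind (S := S) ρ).hom (z.1 (σ, τ, υ)) =
      dTwo (coindRep (ρ.restrict (subgroupIncl S))).toTopRep yt σ τ υ)
    (hcor : twoCocycleClass ρ.toTopRep ⟨_, comp_mem_contTwoCocycles_of_conn hSES yt z hz⟩ ∈ Set.range (cor S ρ 2)) :
    threeCocycleClass ρ.toTopRep z = 0 := by
  obtain ⟨u, hu⟩ := hcor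
  rw [cor_apply] at hu
  obtain ⟨Y, hY⟩ := twoCocycleClass_surjective _ (extMap S ρ 2 u)
  exact threeCocycleClass_conn_eq_zero_of_exists hSES yt z hz ⟨Y, by rw [hY]; exact hu⟩

/-- (α3) **If `H³(G, T) = 0`, the corestriction `cor : H²(S, T) → H²(G, T)` is onto** (`H²(norm)` is onto by the long
exact sequence, `NineTerm.exists_map_two_eq_of_subsingleton_three`, and `H²(norm) = cor ∘ sh` since `ext ∘ sh = id`).
[cite: SerreGaloisCohomology1997, I §2.5] [cite: NeukirchSchmidtWingberg2008, I §3] -/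
theorem mem_range_cor_two_of_subsingleton_three [hS : IsClosed (S : Set G)]
    (hSES : IsSES (unitCoind (S := S) ρ) (normCoind ρ)) [Subsingleton (continuousCohomology 3 ρ.toTopRep)]
    (y : continuousCohomology 2 ρ.toTopRep) : y ∈ Set.range (cor S ρ 2) := by
  obtain ⟨Y', hY'⟩ := hSES.exists_map_two_eq_of_subsingleton_three y
  refine ⟨shMap S ρ 2 Y', ?_⟩
  rw [cor_apply]
  have h := extMap_sh S ρ 1 Y'
  change extMap S ρ 2 (shMap S ρ 2 Y') = Y' at h
  rw [h, hY']

end IndexTwo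

end Summit.BirchSwinnertonDyer.BirchSwinnertonDyer.Theorems.SignedEC.ShaThreeBase

end
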